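import Literature.AlgebraicGeometry.Resolution.StrictNormalCrossingsOpen
import Literature.AlgebraicGeometry.Resolution.ExcellentRings
import HarnessLib

/-!
# The strict normal crossings condition is an open condition on J-2 rings (ring level)

Topic: `Literature/AlgebraicGeometry/Resolution`. Theorem-only file (sorry-free, no definitions, no named facts).
`StrictNormalCrossingsOpen.lean` proves that the local strict normal crossings condition `IsSNCIdeal (I R_𝔭)` spreads from a
prime `𝔭` to a basic open neighbourhood, for algebras of finite type over a PERFECT FIELD — the only input being the openness of
the regular loci of the quotients `R/J_T` (Matsumura, Cor. to Thm. 30.5).  This file records the same proof for **J-2 rings**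
(`IsJ2Ring`, `ExcellentRings.lean`: Noetherian and `Reg(B)` open for every finitely generated `R`-algebra `B`; Matsumura §32,
Stacks 07P7), in particular for quasi-excellent and excellent rings — the form needed on excellent schemes (cell res-hironaka,
rung L W5.2: the snc letters at the END of the contact transport are snc AT the carrier points and must be snc NEAR them).

* `exists_notMem_forall_isRegularLocalRing_quotient_of_isJ2Ring` — regular loci of the quotients spread (J-2);
* `IsSNCIdeal.exists_notMem_forall_of_isJ2Ring` — **the snc condition spreads from a prime to a neighbourhood on a J-2 ring**.

## References
* H. Matsumura, *Commutative Ring Theory* (1986), §32 (p. 260), Thm. 14.2. [Matsumura1987]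
* The Stacks Project, Tags 07P7, 0BI9, 0BIA. [StacksProject]
-/

noncomputable section

open IsLocalRing

universe u

namespace Literature.AlgebraicGeometry.Resolution

variable {R : Type u} [CommRing R]

/-- **Regular loci of quotients spread, J-2 form**: for a J-2 ring `R`, `J ⊆ 𝔭` with `R_𝔭/J R_𝔭` regular, there is `g ∉ 𝔭` with
`R_𝔮/J R_𝔮` regular for all primes `𝔮 ⊇ J` in `D(g)` (the regular locus of the finitely generated `R`-algebra `R/J` is open).
[cite: Matsumura1987, §32 p. 260] [cite: StacksProject, Tag 07P7] -/
theorem exists_notMem_forall_isRegularLocalRing_quotient_of_isJ2Ring (hR : IsJ2Ring R)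
    (J 𝔭 : Ideal R) [𝔭.IsPrime] (hJ : J ≤ 𝔭)
    (hreg : IsRegularLocalRing
      (Localization.AtPrime 𝔭 ⧸ J.map (algebraMap R (Localization.AtPrime 𝔭)))) :
    ∃ g ∉ 𝔭, ∀ (𝔮 : Ideal R) [𝔮.IsPrime], g ∉ 𝔮 → J ≤ 𝔮 →
      IsRegularLocalRing (Localization.AtPrime 𝔮 ⧸ J.map (algebraMap R (Localization.AtPrime 𝔮))) := by
  classical
  let S := R ⧸ J
  haveI : Algebra.FiniteType R S := inferInstance
  have hopen : IsOpen (regularLocus S) := hR.2 S inferInstance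
  haveI h𝔭' : (𝔭.map (Ideal.Quotient.mk J)).IsPrime := Ideal.isPrime_map_quotientMk_of_isPrime hJ
  let P : PrimeSpectrum S := ⟨𝔭.map (Ideal.Quotient.mk J), h𝔭'⟩
  have hP : P ∈ regularLocus S := (isRegularLocalRing_localization_quotient_iff J 𝔭 hJ).mp hreg
  obtain ⟨_, ⟨gbar, rfl⟩, hPg, hgU⟩ :=
    PrimeSpectrum.isTopologicalBasis_basic_opens.exists_subset_of_mem_open hP hopen
  obtain ⟨g, rfl⟩ := Ideal.Quotient.mk_surjective gbar
  refine ⟨g, fun hg => hPg (Ideal.mem_map_of_mem _ hg), fun 𝔮 _ hg𝔮 hJ𝔮 => ?_⟩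
  haveI h𝔮' : (𝔮.map (Ideal.Quotient.mk J)).IsPrime := Ideal.isPrime_map_quotientMk_of_isPrime hJ𝔮
  let Q : PrimeSpectrum S := ⟨𝔮.map (Ideal.Quotient.mk J), h𝔮'⟩
  have hQg : Q ∈ PrimeSpectrum.basicOpen (Ideal.Quotient.mk J g) := by
    change Ideal.Quotient.mk J g ∉ 𝔮.map (Ideal.Quotient.mk J)
    intro hmem
    apply hg𝔮
    have : g ∈ (𝔮.map (Ideal.Quotient.mk J)).comap (Ideal.Quotient.mk J) := hmem
    rwa [Ideal.comap_map_of_surjective _ Ideal.Quotient.mk_surjective, ← RingHom.ker_eq_comap_bot,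
      Ideal.mk_ker, sup_eq_left.mpr hJ𝔮] at this
  exact (isRegularLocalRing_localization_quotient_iff J 𝔮 hJ𝔮).mpr (hgU hQg)


/-- **The strict normal crossings condition spreads from a prime to a neighbourhood on a J-2 ring** (same proof as
`IsSNCIdeal.exists_notMem_forall`, with the J-2 openness of the regular loci of the quotients `R/J_T`). [cite: StacksProject, Tag 0BIA]
[cite: Matsumura1987, Thm. 14.2] -/
theorem IsSNCIdeal.exists_notMem_forall_of_isJ2Ring (hR : IsJ2Ring R) (I 𝔭 : Ideal R) [𝔭.IsPrime]
    (h : IsSNCIdeal (I.map (algebraMap R (Localization.AtPrime 𝔭)))) :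
    ∃ f ∉ 𝔭, ∀ (𝔮 : Ideal R) [𝔮.IsPrime], f ∉ 𝔮 → I ≤ 𝔮 →
      IsSNCIdeal (I.map (algebraMap R (Localization.AtPrime 𝔮))) := by
  classical
  haveI : IsNoetherianRing R := hR.1
  set A := Localization.AtPrime 𝔭 with hA
  haveI hregA : IsRegularLocalRing A := h.isRegularLocalRing
  obtain ⟨r, x, hx, hr, hli, hIA⟩ := h.exists_linearIndependent
  /- (1) clear denominators: `x i = a i / s i`; the images `x' i` of the `a i` differ from the
  `x i` by units -/
  choose as has using fun i => IsLocalization.surj 𝔭.primeCompl (x i)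
  let a : Fin r → R := fun i => (as i).1
  have hsunit : ∀ i, IsUnit (algebraMap R A ((as i).2 : R)) := fun i =>
    IsLocalization.map_units A (as i).2
  let x' : Fin r → A := fun i => algebraMap R A (a i)
  have hax : ∀ i, x' i = x i * algebraMap R A ((as i).2 : R) := fun i => (has i).symm
  have hx' : ∀ i, x' i ∈ maximalIdeal A := fun i => by
    rw [hax i]
    exact Ideal.mul_mem_right _ _ (hx i)
  have ha𝔭 : ∀ i, a i ∈ 𝔭 := fun i =>
    (IsLocalization.AtPrime.to_map_mem_maximal_iff A 𝔭 (a i)).mp (hx' i)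
  have hli' : LinearIndependent (ResidueField A)
      fun i => (maximalIdeal A).toCotangent ⟨x' i, hx' i⟩ := by
    have := hli.units_smul fun i => Units.map (IsLocalRing.residue A).toMonoidHom (hsunit i).unit
    convert this using 1
    funext i
    rw [Pi.smul_apply', Units.smul_def, Units.coe_map]
    change _ = ((hsunit i).unit : A) • (maximalIdeal A).toCotangent ⟨x i, hx i⟩
    rw [← LinearMap.map_smul_of_tower]
    congr 1
    apply Subtype.ext
    change x' i = ((hsunit i).unit : A) * x i
    rw [IsUnit.unit_spec, mul_comm]
    exact hax i
  -- `I A = (∏ a i) A`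
  have hIA' : I.map (algebraMap R A) = (Ideal.span {∏ i, a i}).map (algebraMap R A) := by
    rw [hIA, Ideal.map_span, Set.image_singleton, map_prod]
    have hprod : ∏ i, algebraMap R A (a i) = (∏ i, x i) * ∏ i, algebraMap R A ((as i).2 : R) := by
      rw [← Finset.prod_mul_distrib]
      exact Finset.prod_congr rfl fun i _ => hax i
    rw [hprod, Ideal.span_singleton_mul_right_unit]
    exact isUnit_prod_algebraMap_of_forall_notMem _ _ 𝔭 fun i _ => (as i).2.2
  /- (2) spread the equality `I = (∏ a i)` to a neighbourhood -/
  obtain ⟨f₀, hf₀, hIq⟩ := Ideal.exists_notMem_forall_map_eq 𝔭 (IsNoetherian.noetherian I)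
    (IsNoetherian.noetherian _) hIA'
  /- (3) the ideals `J T = (a i : i ∈ T)`; at `𝔭` their extensions are generated by elements
  with independent differentials -/
  let J : Finset (Fin r) → Ideal R := fun T => Ideal.span (a '' (T : Set (Fin r)))
  have hJA : ∀ T, (J T).map (algebraMap R A) = Ideal.span (x' '' (T : Set (Fin r))) := by
    intro T
    rw [Ideal.map_span, Set.image_image]
  have hJle : ∀ (T : Finset (Fin r)) (𝔮 : Ideal R), (∀ i ∈ T, a i ∈ 𝔮) → J T ≤ 𝔮 := by
    intro T 𝔮 hT
    rw [Ideal.span_le]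
    rintro _ ⟨i, hi, rfl⟩
    exact hT i hi
  have hJ𝔭 : ∀ T, J T ≤ 𝔭 := fun T => hJle T 𝔭 fun i _ => ha𝔭 i
  have hregJ : ∀ T, IsRegularLocalRing (A ⧸ (J T).map (algebraMap R A)) := by
    intro T
    haveI := isRegularLocalRing_quotient_span_image_of_linearIndependent_toCotangent x' hx' hli'
      (T : Set (Fin r))
    exact IsRegularLocalRing.of_ringEquiv (Ideal.quotEquivOfEq (hJA T).symm)
  have hprimeJ : ∀ T, ((J T).map (algebraMap R A)).IsPrime := by
    intro T
    rw [hJA T]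
    exact isPrime_span_image_of_linearIndependent_toCotangent x' hx' hli' _
  -- (a) regular loci of the `R / J T` around `𝔭`
  choose g hg hgreg using fun T : Finset (Fin r) =>
    exists_notMem_forall_isRegularLocalRing_quotient_of_isJ2Ring hR (J T) 𝔭 (hJ𝔭 T) (hregJ T)
  -- (b) minimal primes of the `J T` near `𝔭` lie inside `𝔭`
  choose hm hhm hhmin using fun T : Finset (Fin r) =>
    Ideal.exists_notMem_forall_minimalPrimes_le (J T) 𝔭
  /- (4) the element `f` -/
  refine ⟨f₀ * ∏ T, (g T * hm T), ?_, fun 𝔮 _ hf𝔮 hI𝔮 => ?_⟩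
  · exact mul_mem (s := 𝔭.primeCompl) hf₀
      (prod_mem (S := 𝔭.primeCompl) fun T _ => mul_mem (hg T) (hhm T))
  /- (5) at a prime `𝔮 ∋ f̸` containing `I` -/
  set B := Localization.AtPrime 𝔮 with hB
  have hf₀𝔮 : f₀ ∉ 𝔮 := notMem_of_dvd_of_notMem (dvd_mul_right _ _) hf𝔮
  have hprod𝔮 : ∏ T, (g T * hm T) ∉ 𝔮 := notMem_of_dvd_of_notMem (dvd_mul_left _ _) hf𝔮
  have hg𝔮 : ∀ T, g T ∉ 𝔮 := fun T =>
    notMem_of_dvd_of_notMem ((dvd_mul_right _ _).trans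
      (Finset.dvd_prod_of_mem (fun T => g T * hm T) (Finset.mem_univ T))) hprod𝔮
  have hhm𝔮 : ∀ T, hm T ∉ 𝔮 := fun T =>
    notMem_of_dvd_of_notMem ((dvd_mul_left _ _).trans
      (Finset.dvd_prod_of_mem (fun T => g T * hm T) (Finset.mem_univ T))) hprod𝔮
  -- the indices of the `a i` vanishing at `𝔮`
  set T₀ : Finset (Fin r) := Finset.univ.filter fun i => a i ∈ 𝔮 with hT₀
  have hmemT₀ : ∀ i, i ∈ T₀ ↔ a i ∈ 𝔮 := fun i => by simp [hT₀]
  -- `I B = (∏_{i ∈ T₀} a i) B`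
  have hIB : I.map (algebraMap R B) = Ideal.span {∏ i ∈ T₀, algebraMap R B (a i)} := by
    rw [hIq 𝔮 hf₀𝔮, Ideal.map_span, Set.image_singleton, map_prod,
      ← Finset.prod_filter_mul_prod_filter_not Finset.univ (fun i => a i ∈ 𝔮)]
    rw [Ideal.span_singleton_mul_right_unit]
    exact isUnit_prod_algebraMap_of_forall_notMem _ _ 𝔮 fun i hi => (Finset.mem_filter.mp hi).2
  -- `T₀` is non-empty as `I ⊆ 𝔮`
  have hT₀ne : T₀.Nonempty := by
    by_contra hne
    rw [Finset.not_nonempty_iff_eq_empty] at hne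
    rw [hne, Finset.prod_empty, Ideal.span_singleton_one] at hIB
    have hle : I.map (algebraMap R B) ≤ maximalIdeal B := by
      rw [← Localization.AtPrime.map_eq_maximalIdeal]
      exact Ideal.map_mono hI𝔮
    rw [hIB] at hle
    exact (maximalIdeal.isMaximal B).ne_top (top_le_iff.mp hle)
  -- enumerate `T₀`
  set t := T₀.card with ht
  let ε : Fin t ≃ T₀ := T₀.equivFin.symm
  let z : Fin t → B := fun j => algebraMap R B (a (ε j))
  have hzT₀ : ∀ j, ((ε j : Fin r)) ∈ T₀ := fun j => (ε j).2
  have hz : ∀ j, z j ∈ maximalIdeal B := fun j =>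
    (IsLocalization.AtPrime.to_map_mem_maximal_iff B 𝔮 _).mpr ((hmemT₀ _).mp (hzT₀ j))
  have ht1 : 1 ≤ t := Finset.card_pos.mpr hT₀ne
  -- images of sub-families of `T₀` as extensions of the `J T`
  let ι' : Finset (Fin t) → Finset (Fin r) := fun S => S.image fun j => (ε j : Fin r)
  have himage : ∀ S : Finset (Fin t),
      z '' (S : Set (Fin t)) = algebraMap R B '' (a '' (ι' S : Set (Fin r))) := by
    intro S
    simp only [ι', Finset.coe_image, Set.image_image]
    rfl
  have hspanS : ∀ S : Finset (Fin t),
      Ideal.span (z '' (S : Set (Fin t))) = (J (ι' S)).map (algebraMap R B) := by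
    intro S
    rw [himage S, Ideal.map_span]
  have hι'T₀ : ∀ (S : Finset (Fin t)), ∀ i ∈ ι' S, i ∈ T₀ := by
    intro S i hi
    obtain ⟨j, -, rfl⟩ := Finset.mem_image.mp hi
    exact hzT₀ j
  have hJ𝔮 : ∀ S : Finset (Fin t), J (ι' S) ≤ 𝔮 :=
    fun S => hJle _ 𝔮 fun i hi => (hmemT₀ i).mp (hι'T₀ S i hi)
  -- (a) at `𝔮`: the quotients `B / (z_S)` are regular
  have hregS : ∀ S : Finset (Fin t),
      IsRegularLocalRing (B ⧸ (J (ι' S)).map (algebraMap R B)) :=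
    fun S => hgreg _ 𝔮 (hg𝔮 _) (hJ𝔮 S)
  haveI : IsRegularLocalRing (B ⧸ Ideal.span (Set.range z)) := by
    rw [← Set.image_univ, ← Finset.coe_univ, hspanS]
    exact hregS _
  -- `B` itself is regular (`S = ∅`)
  haveI hregB : IsRegularLocalRing B := by
    have h0 := hregS ∅
    rw [← hspanS, Finset.coe_empty, Set.image_empty, Ideal.span_empty] at h0
    exact IsRegularLocalRing.of_ringEquiv (RingEquiv.quotientBot B)
  -- minimality: no `z j` lies in the ideal of the others
  have hmin : ∀ j, z j ∉ Ideal.span (z '' {j' | j' ≠ j}) := by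
    intro j
    have hset : ({j' | j' ≠ j} : Set (Fin t)) = ((Finset.univ.erase j : Finset (Fin t)) : Set (Fin t)) := by
      ext j'
      simp
    rw [hset, hspanS]
    refine algebraMap_notMem_map_span_image 𝔭 𝔮 a hx' hli' _ ?_ (hregS _) ?_
    · intro hi
      obtain ⟨j', hj', hjj'⟩ := Finset.mem_image.mp hi
      exact (Finset.mem_erase.mp hj').1 (ε.injective (Subtype.ext hjj'))
    · intro P hP hP𝔮
      exact hhmin _ P hP fun hh => hhm𝔮 _ (hP𝔮 hh)
  -- conclude
  have hprodz : ∏ j, z j = ∏ i ∈ T₀, algebraMap R B (a i) := by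
    rw [← Finset.prod_coe_sort T₀]
    exact Fintype.prod_equiv ε _ (fun i : T₀ => algebraMap R B (a i)) fun j => rfl
  refine IsSNCIdeal.of_isRegularLocalRing_quotient ht1 z hz hmin ?_
  rw [hIB, hprodz]


/-- **Independent differentials spread, J-2 / LIST form** (the same proof, recorded with the conclusion the list currency
`HasSNC` consumes): for a J-2 ring `R`, elements `a₁, …, a_r ∈ 𝔭` whose images in the regular local ring `R_𝔭` have linearly
independent differentials, there is `f ∉ 𝔭` such that at every prime `𝔮 ∌ f`, `R_𝔮` is regular and the `a_i ∈ 𝔮` have linearly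
independent differentials in `R_𝔮` (so extend to a regular system of parameters of `R_𝔮`, `IsSNCIdeal.of_linearIndependent` /
Matsumura 14.2). [cite: Matsumura1987, Thm. 14.2, §32 p. 260] [cite: StacksProject, Tag 07P7] -/
theorem exists_notMem_forall_linearIndependent_toCotangent_of_isJ2Ring (hR : IsJ2Ring R) (𝔭 : Ideal R) [𝔭.IsPrime]
    [hregA : IsRegularLocalRing (Localization.AtPrime 𝔭)] {r : ℕ} (a : Fin r → R) (ha𝔭 : ∀ i, a i ∈ 𝔭)
    (hli' : LinearIndependent (ResidueField (Localization.AtPrime 𝔭)) fun i =>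
      (maximalIdeal (Localization.AtPrime 𝔭)).toCotangent ⟨algebraMap R (Localization.AtPrime 𝔭) (a i),
        (IsLocalization.AtPrime.to_map_mem_maximal_iff (Localization.AtPrime 𝔭) 𝔭 (a i)).mpr (ha𝔭 i)⟩) :
    ∃ f ∉ 𝔭, ∀ (𝔮 : Ideal R) [𝔮.IsPrime], f ∉ 𝔮 →
      IsRegularLocalRing (Localization.AtPrime 𝔮) ∧
      ∀ (t : ℕ) (ε : Fin t → Fin r), Function.Injective ε → (∀ j, a (ε j) ∈ 𝔮) →
        ∃ hz : ∀ j, algebraMap R (Localization.AtPrime 𝔮) (a (ε j)) ∈ maximalIdeal (Localization.AtPrime 𝔮),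
          LinearIndependent (ResidueField (Localization.AtPrime 𝔮)) fun j =>
            (maximalIdeal (Localization.AtPrime 𝔮)).toCotangent ⟨algebraMap R (Localization.AtPrime 𝔮) (a (ε j)), hz j⟩ := by
  classical
  haveI : IsNoetherianRing R := hR.1
  set A := Localization.AtPrime 𝔭 with hA
  let x' : Fin r → A := fun i => algebraMap R A (a i)
  have hx' : ∀ i, x' i ∈ maximalIdeal A := fun i =>
    (IsLocalization.AtPrime.to_map_mem_maximal_iff A 𝔭 (a i)).mpr (ha𝔭 i)
  /- (3) the ideals `J T = (a i : i ∈ T)`; at `𝔭` their extensions are generated by elements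
  with independent differentials -/
  let J : Finset (Fin r) → Ideal R := fun T => Ideal.span (a '' (T : Set (Fin r)))
  have hJA : ∀ T, (J T).map (algebraMap R A) = Ideal.span (x' '' (T : Set (Fin r))) := by
    intro T
    rw [Ideal.map_span, Set.image_image]
  have hJle : ∀ (T : Finset (Fin r)) (𝔮 : Ideal R), (∀ i ∈ T, a i ∈ 𝔮) → J T ≤ 𝔮 := by
    intro T 𝔮 hT
    rw [Ideal.span_le]
    rintro _ ⟨i, hi, rfl⟩
    exact hT i hi
  have hJ𝔭 : ∀ T, J T ≤ 𝔭 := fun T => hJle T 𝔭 fun i _ => ha𝔭 i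
  have hregJ : ∀ T, IsRegularLocalRing (A ⧸ (J T).map (algebraMap R A)) := by
    intro T
    haveI := isRegularLocalRing_quotient_span_image_of_linearIndependent_toCotangent x' hx' hli'
      (T : Set (Fin r))
    exact IsRegularLocalRing.of_ringEquiv (Ideal.quotEquivOfEq (hJA T).symm)
  have hprimeJ : ∀ T, ((J T).map (algebraMap R A)).IsPrime := by
    intro T
    rw [hJA T]
    exact isPrime_span_image_of_linearIndependent_toCotangent x' hx' hli' _
  -- (a) regular loci of the `R / J T` around `𝔭`
  choose g hg hgreg using fun T : Finset (Fin r) =>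
    exists_notMem_forall_isRegularLocalRing_quotient_of_isJ2Ring hR (J T) 𝔭 (hJ𝔭 T) (hregJ T)
  -- (b) minimal primes of the `J T` near `𝔭` lie inside `𝔭`
  choose hm hhm hhmin using fun T : Finset (Fin r) =>
    Ideal.exists_notMem_forall_minimalPrimes_le (J T) 𝔭
  /- (4) the element `f` -/
  refine ⟨∏ T, (g T * hm T), ?_, fun 𝔮 _ hf𝔮 => ?_⟩
  · exact prod_mem (S := 𝔭.primeCompl) fun T _ => mul_mem (hg T) (hhm T)
  /- (5) at a prime `𝔮 ∋ f̸` containing `I` -/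
  set B := Localization.AtPrime 𝔮 with hB
  have hprod𝔮 : ∏ T, (g T * hm T) ∉ 𝔮 := hf𝔮
  have hg𝔮 : ∀ T, g T ∉ 𝔮 := fun T =>
    notMem_of_dvd_of_notMem ((dvd_mul_right _ _).trans
      (Finset.dvd_prod_of_mem (fun T => g T * hm T) (Finset.mem_univ T))) hprod𝔮
  have hhm𝔮 : ∀ T, hm T ∉ 𝔮 := fun T =>
    notMem_of_dvd_of_notMem ((dvd_mul_left _ _).trans
      (Finset.dvd_prod_of_mem (fun T => g T * hm T) (Finset.mem_univ T))) hprod𝔮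
  -- sub-families through `𝔮` as extensions of the `J T`
  have hJ𝔮' : ∀ T : Finset (Fin r), (∀ i ∈ T, a i ∈ 𝔮) → IsRegularLocalRing (B ⧸ (J T).map (algebraMap R B)) :=
    fun T hT => hgreg _ 𝔮 (hg𝔮 _) (hJle T 𝔮 hT)
  -- `B` itself is regular (`T = ∅`)
  haveI hregB : IsRegularLocalRing B := by
    have h0 := hJ𝔮' ∅ (by simp)
    have hempty : (J ∅).map (algebraMap R B) = ⊥ := by
      show (Ideal.span (a '' ((∅ : Finset (Fin r)) : Set (Fin r)))).map (algebraMap R B) = ⊥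
      rw [Finset.coe_empty, Set.image_empty, Ideal.span_empty, Ideal.map_bot]
    rw [hempty] at h0
    exact IsRegularLocalRing.of_ringEquiv (RingEquiv.quotientBot B)
  refine ⟨hregB, fun t ε hε hε𝔮 => ?_⟩
  let z : Fin t → B := fun j => algebraMap R B (a (ε j))
  have hz : ∀ j, z j ∈ maximalIdeal B := fun j =>
    (IsLocalization.AtPrime.to_map_mem_maximal_iff B 𝔮 _).mpr (hε𝔮 j)
  let ι' : Finset (Fin t) → Finset (Fin r) := fun S => S.image ε
  have himage : ∀ S : Finset (Fin t),
      z '' (S : Set (Fin t)) = algebraMap R B '' (a '' (ι' S : Set (Fin r))) := by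
    intro S
    simp only [ι', Finset.coe_image, Set.image_image]
    rfl
  have hspanS : ∀ S : Finset (Fin t),
      Ideal.span (z '' (S : Set (Fin t))) = (J (ι' S)).map (algebraMap R B) := by
    intro S
    rw [himage S, Ideal.map_span]
  have hι'𝔮 : ∀ (S : Finset (Fin t)), ∀ i ∈ ι' S, a i ∈ 𝔮 := by
    intro S i hi
    obtain ⟨j, -, rfl⟩ := Finset.mem_image.mp hi
    exact hε𝔮 j
  have hregS : ∀ S : Finset (Fin t), IsRegularLocalRing (B ⧸ (J (ι' S)).map (algebraMap R B)) :=
    fun S => hJ𝔮' _ (hι'𝔮 S)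
  haveI : IsRegularLocalRing (B ⧸ Ideal.span (Set.range z)) := by
    rw [← Set.image_univ, ← Finset.coe_univ, hspanS]
    exact hregS _
  -- minimality: no `z j` lies in the ideal of the others
  have hmin : ∀ j, z j ∉ Ideal.span (z '' {j' | j' ≠ j}) := by
    intro j
    have hset : ({j' | j' ≠ j} : Set (Fin t)) = ((Finset.univ.erase j : Finset (Fin t)) : Set (Fin t)) := by
      ext j'
      simp
    rw [hset, hspanS]
    refine algebraMap_notMem_map_span_image 𝔭 𝔮 a hx' hli' _ ?_ (hregS _) ?_
    · intro hi
      obtain ⟨j', hj', hjj'⟩ := Finset.mem_image.mp hi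
      exact (Finset.mem_erase.mp hj').1 (hε hjj')
    · intro P hP hP𝔮
      exact hhmin _ P hP fun hh => hhm𝔮 _ (hP𝔮 hh)
  exact ⟨hz, linearIndependent_toCotangent_of_isRegularLocalRing_quotient z hz hmin⟩

/-- **From independent differentials to the `HasSNC` currency**: elements `x₁, …, x_r ∈ 𝔪` of a regular local ring with linearly
independent differentials are, up to reindexing, members of a minimal basis `u` of `𝔪` on `Fin (emb dim)` (an injective labelling
`ι` with `u (ι i) = x i`). [cite: Matsumura1987, Thm. 14.2] -/
theorem exists_rsop_labels_of_linearIndependent_toCotangent {A : Type u} [CommRing A] [IsRegularLocalRing A] {r : ℕ}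
    (x : Fin r → A) (hx : ∀ i, x i ∈ maximalIdeal A)
    (hli : LinearIndependent (ResidueField A) fun i => (maximalIdeal A).toCotangent ⟨x i, hx i⟩) :
    ∃ u : Fin (maximalIdeal A).spanFinrank → A, Ideal.span (Set.range u) = maximalIdeal A ∧
      ∃ ι : Fin r → Fin (maximalIdeal A).spanFinrank, Function.Injective ι ∧ ∀ i, u (ι i) = x i := by
  classical
  have hind := (linearIndependent_toCotangent_iff_forall_mem x hx).mp hli
  obtain ⟨e, y, hdim, hspan⟩ := exists_extend_to_rsop x hx hind
  have hsfr : (maximalIdeal A).spanFinrank = r + e := by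
    have h := IsRegularLocalRing.spanFinrank_maximalIdeal (R := A)
    rw [hdim] at h
    exact_mod_cast h
  refine ⟨fun j => Fin.append x y (Fin.cast hsfr j), ?_, fun i => Fin.cast hsfr.symm (Fin.castAdd e i), ?_, fun i => ?_⟩
  · have h1 : (Set.range fun j => Fin.append x y (Fin.cast hsfr j)) = Set.range (Fin.append x y) := by
      ext a
      constructor
      · rintro ⟨j, rfl⟩; exact ⟨_, rfl⟩
      · rintro ⟨j, rfl⟩; exact ⟨Fin.cast hsfr.symm j, by simp⟩
    have h2 : Set.range (Fin.append x y) = Set.range x ∪ Set.range y := by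
      ext a
      constructor
      · rintro ⟨j, rfl⟩
        refine Fin.addCases (motive := fun j => Fin.append x y j ∈ Set.range x ∪ Set.range y) (fun i => ?_) (fun i => ?_) j
        · rw [Fin.append_left]; exact Or.inl ⟨i, rfl⟩
        · rw [Fin.append_right]; exact Or.inr ⟨i, rfl⟩
      · rintro (⟨i, rfl⟩ | ⟨i, rfl⟩)
        · exact ⟨Fin.castAdd e i, by rw [Fin.append_left]⟩
        · exact ⟨Fin.natAdd r i, by rw [Fin.append_right]⟩
    rw [h1, h2, hspan]
  · intro i j h
    have h' : Fin.castAdd e i = Fin.castAdd e j := by simpa using h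
    exact Fin.castAdd_injective _ _ h'
  · simp

end Literature.AlgebraicGeometry.Resolution

end
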